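import Summits.MatrixMultiplication.MatrixMultiplication.Theorems.GradedDesignFamily.Negative.FamilyNeumann

/-!
# Simultaneously separated families never tile: `W_XY + W_YZ + W_ZX ≤ 2 dim J + 1`
# (crux `LevelGradedCohnUmans.GradedDesignFamily`, stmt-MatrixMultiplication-7610; negative side, lead c3)

Consequences of the family Neumann counts `familyNeumann_Z` / `familyNeumann_X`
(`Negative/FamilyNeumann.lean`) for a BI-INVARIANT `J ≤ ℂ^G` and a simultaneously `J`-separated
family `(X_i, Y_i, Z_i)_i` with all blocks non-empty:

* `familyWalls_sum_le` — `W_XY + W_YZ + W_ZX ≤ 2·dim J + 1` (add the two counts at the same block `i`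
  and use `|X_i| + |Z_i| ≤ |X_i||Z_i| + 1 ≤ W_ZX + 1`);
* `three_mul_sum_rpow_le` — `3·Σ_i V_i^{2/3} ≤ 2·dim J + 1` (`V_i = |X_i||Y_i||Z_i|`, AM–GM per block),
  i.e. the TILING EFFICIENCY `η = Σ_i V_i^{2/3} / dim J` of every family is `≤ 2/3 + 1/(3 dim J)`
  (the perfect `S₃` design `({1,(12)},{1,(13)},{1,(23)})`, `V = 8`, `dim J = 6`, attains `2/3`);
* `sharp_family_cap` — `3·2^{1/3}·Σ_i V_i^{2/3} ≤ 2·dim J + |X_{i₀}| + |Z_{i₀}|`: asymptotically the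
  family efficiency is capped by the SAME constant `(2/(3√3))^{2/3} = 0.529…` as a single design;
* `tilingFamilies_false` — hence the registered stub `stub_tilingFamilies` of the strategist line
  `tiling-families` (regime II of the family criterion: `∃ λ > 1 ∀ η < 1` a family with
  `V_i ≥ (λ χ(1))³` for all visible `χ` and `η·Σ_{Irr∩J} χ(1)² ≤ Σ_i V_i^{2/3}`) is FALSE: with
  `dim J ≤ Σ_{Irr∩J} χ(1)² =: D` (`finrank_le_gradedBudget_two`) no family reaches efficiency `11/12`
  once `dim J ≥ 2`, and `dim J = 1` carries no block of volume `> 1`.  Regime II is dead; by the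
  landed family criterion `η λ^ε > 1` (`stub_tilingUniversality`) every family route to the crux
  needs `λ^ε > 3/2 − o(1)`, i.e. `λ → ∞` as `ε → 0`: universality cells are the only regime.

Sorry-free; axioms `propext`, `Classical.choice`, `Quot.sound`.
-/

set_option linter.dupNamespace false

noncomputable section

open scoped BigOperators
open Module Literature.RepresentationTheory.FiniteGroups

namespace Summit.MatrixMultiplication.MatrixMultiplication.Theorems.GradedDesignFamily.Negative

/-! ## Consequences: the three walls sum to at most `2 dim J + 1`; no tiling -/

/-- **The three family walls sum to at most `2·dim J + 1`** (bi-invariant `J`, all blocks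
non-empty): `W_XY + W_YZ + W_ZX ≤ 2·dim J + 1`. -/
theorem familyWalls_sum_le {G : Type} [Group G] {ι : Type} [Fintype G] [Fintype ι]
    (J : Submodule ℂ (G → ℂ))
    (hJ : ∀ f ∈ J, ∀ a b : G, (fun g : G => f (a * g * b)) ∈ J)
    (X Y Z : ι → Finset G) (hX : ∀ i, (X i).Nonempty) (hY : ∀ i, (Y i).Nonempty)
    (hZ : ∀ i, (Z i).Nonempty)
    (hsep : ∀ i : ι, ∀ x₀ ∈ X i, ∀ z₀ ∈ Z i, ∃ f ∈ J, ∀ a b : ι, ∀ x ∈ X a, ∀ y ∈ Y a,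
      ∀ y' ∈ Y b, ∀ z ∈ Z b,
        ((a = i ∧ b = i ∧ x = x₀ ∧ y = y' ∧ z = z₀) → f (x⁻¹ * y * y'⁻¹ * z) = 1) ∧
        (¬ (a = i ∧ b = i ∧ x = x₀ ∧ y = y' ∧ z = z₀) → f (x⁻¹ * y * y'⁻¹ * z) = 0)) :
    ∑ i, ((X i).card * (Y i).card + (Y i).card * (Z i).card + (Z i).card * (X i).card) ≤
      2 * Module.finrank ℂ J + 1 := by
  classical
  rcases isEmpty_or_nonempty ι with hι | ⟨⟨i₀⟩⟩
  · simp
  have hL : ∀ f ∈ J, ∀ a : G, (fun g : G => f (a * g)) ∈ J := fun f hf a => by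
    simpa using hJ f hf a 1
  have hR : ∀ f ∈ J, ∀ b : G, (fun g : G => f (g * b)) ∈ J := fun f hf b => by
    simpa using hJ f hf 1 b
  have hNZ := familyNeumann_Z J hL X Y Z hX hY hsep i₀
  have hNX := familyNeumann_X J hR X Y Z hY hZ hsep i₀
  have hterm : (Z i₀).card * (X i₀).card ≤ ∑ i, (Z i).card * (X i).card :=
    Finset.single_le_sum (f := fun i => (Z i).card * (X i).card) (fun i _ => Nat.zero_le _)
      (Finset.mem_univ i₀)
  have hx : 1 ≤ (X i₀).card := Finset.card_pos.mpr (hX i₀)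
  have hz : 1 ≤ (Z i₀).card := Finset.card_pos.mpr (hZ i₀)
  have hab : (X i₀).card + (Z i₀).card ≤ (Z i₀).card * (X i₀).card + 1 := by nlinarith
  rw [Finset.sum_add_distrib, Finset.sum_add_distrib]
  omega

/-- AM–GM for a block: `(abc)^{2/3} ≤ (ab + bc + ca)/3`. -/
theorem rpow_two_thirds_le (a b c : ℕ) :
    ((a * b * c : ℕ) : ℝ) ^ ((2 : ℝ) / 3) ≤ ((a * b + b * c + c * a : ℕ) : ℝ) / 3 := by
  have ha : (0 : ℝ) ≤ a := Nat.cast_nonneg a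
  have hb : (0 : ℝ) ≤ b := Nat.cast_nonneg b
  have hc : (0 : ℝ) ≤ c := Nat.cast_nonneg c
  have h := Real.geom_mean_le_arith_mean3_weighted (w₁ := 1 / 3) (w₂ := 1 / 3) (w₃ := 1 / 3)
    (p₁ := (a : ℝ) * b) (p₂ := (b : ℝ) * c) (p₃ := (c : ℝ) * a) (by norm_num) (by norm_num)
    (by norm_num) (mul_nonneg ha hb) (mul_nonneg hb hc) (mul_nonneg hc ha) (by norm_num)
  have hprod : ((a : ℝ) * b) ^ ((1 : ℝ) / 3) * ((b : ℝ) * c) ^ ((1 : ℝ) / 3) *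
      ((c : ℝ) * a) ^ ((1 : ℝ) / 3) = ((a * b * c : ℕ) : ℝ) ^ ((2 : ℝ) / 3) := by
    rw [← Real.mul_rpow (mul_nonneg ha hb) (mul_nonneg hb hc),
      ← Real.mul_rpow (mul_nonneg (mul_nonneg ha hb) (mul_nonneg hb hc)) (mul_nonneg hc ha)]
    have hsq : (a : ℝ) * b * (b * c) * (c * a) = ((a : ℝ) * b * c) ^ (2 : ℕ) := by ring
    rw [hsq, ← Real.rpow_natCast _ 2, ← Real.rpow_mul (mul_nonneg (mul_nonneg ha hb) hc)]
    push_cast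
    norm_num
  rw [hprod] at h
  have hrhs : 1 / 3 * ((a : ℝ) * b) + 1 / 3 * ((b : ℝ) * c) + 1 / 3 * ((c : ℝ) * a) =
      ((a * b + b * c + c * a : ℕ) : ℝ) / 3 := by push_cast; ring
  linarith [hrhs]

/-- Weighted AM–GM for a block: `2^{1/3}·(abc)^{2/3} ≤ (ab + bc + 2ca)/3`. -/
theorem two_rpow_third_mul_rpow_two_thirds_le (a b c : ℕ) :
    (2 : ℝ) ^ ((1 : ℝ) / 3) * ((a * b * c : ℕ) : ℝ) ^ ((2 : ℝ) / 3) ≤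
      ((a * b + b * c + 2 * (c * a) : ℕ) : ℝ) / 3 := by
  have ha : (0 : ℝ) ≤ a := Nat.cast_nonneg a
  have hb : (0 : ℝ) ≤ b := Nat.cast_nonneg b
  have hc : (0 : ℝ) ≤ c := Nat.cast_nonneg c
  have h2 : (0 : ℝ) ≤ 2 * ((c : ℝ) * a) := by positivity
  have h := Real.geom_mean_le_arith_mean3_weighted (w₁ := 1 / 3) (w₂ := 1 / 3) (w₃ := 1 / 3)
    (p₁ := (a : ℝ) * b) (p₂ := (b : ℝ) * c) (p₃ := 2 * ((c : ℝ) * a)) (by norm_num) (by norm_num)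
    (by norm_num) (mul_nonneg ha hb) (mul_nonneg hb hc) h2 (by norm_num)
  have hprod : ((a : ℝ) * b) ^ ((1 : ℝ) / 3) * ((b : ℝ) * c) ^ ((1 : ℝ) / 3) *
      (2 * ((c : ℝ) * a)) ^ ((1 : ℝ) / 3) =
        (2 : ℝ) ^ ((1 : ℝ) / 3) * ((a * b * c : ℕ) : ℝ) ^ ((2 : ℝ) / 3) := by
    rw [← Real.mul_rpow (mul_nonneg ha hb) (mul_nonneg hb hc),
      ← Real.mul_rpow (mul_nonneg (mul_nonneg ha hb) (mul_nonneg hb hc)) h2]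
    have hsq : (a : ℝ) * b * (b * c) * (2 * (c * a)) = 2 * ((a : ℝ) * b * c) ^ (2 : ℕ) := by ring
    rw [hsq, Real.mul_rpow (by norm_num) (by positivity), ← Real.rpow_natCast _ 2,
      ← Real.rpow_mul (mul_nonneg (mul_nonneg ha hb) hc)]
    push_cast
    norm_num
  rw [hprod] at h
  have hrhs : 1 / 3 * ((a : ℝ) * b) + 1 / 3 * ((b : ℝ) * c) + 1 / 3 * (2 * ((c : ℝ) * a)) =
      ((a * b + b * c + 2 * (c * a) : ℕ) : ℝ) / 3 := by push_cast; ring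
  linarith [hrhs]

/-- **Sharp family cap**: for a bi-invariant `J` and a simultaneously `J`-separated family with
non-empty blocks, `3·2^{1/3}·Σ_i V_i^{2/3} ≤ 2·dim J + |X_{i₀}| + |Z_{i₀}|` for every block `i₀`
(the X- and Z-counts at `i₀`, weighted AM–GM `ab + bc + 2ca ≥ 3·2^{1/3}(abc)^{2/3}` per block).
Asymptotically (`|X_{i₀}| + |Z_{i₀}| = o(dim J)` for some block, which any family of efficiency
bounded below must have) this is `Σ_i V_i^{2/3} ≤ (2/(3·2^{1/3}) + o(1))·dim J = (0.529… + o(1))·dim J`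
— the SAME constant `(2/(3√3))^{2/3}` as the single-design graded Neumann cap `V ≤ ψ(dim J)`:
simultaneity relaxes which objects are needed (`t` blocks of volume `(dim J/t)^{3/2}`), never the total
packing efficiency. -/
theorem sharp_family_cap {G : Type} [Group G] {ι : Type} [Fintype G] [Fintype ι]
    (J : Submodule ℂ (G → ℂ))
    (hJ : ∀ f ∈ J, ∀ a b : G, (fun g : G => f (a * g * b)) ∈ J)
    (X Y Z : ι → Finset G) (hX : ∀ i, (X i).Nonempty) (hY : ∀ i, (Y i).Nonempty)
    (hZ : ∀ i, (Z i).Nonempty)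
    (hsep : ∀ i : ι, ∀ x₀ ∈ X i, ∀ z₀ ∈ Z i, ∃ f ∈ J, ∀ a b : ι, ∀ x ∈ X a, ∀ y ∈ Y a,
      ∀ y' ∈ Y b, ∀ z ∈ Z b,
        ((a = i ∧ b = i ∧ x = x₀ ∧ y = y' ∧ z = z₀) → f (x⁻¹ * y * y'⁻¹ * z) = 1) ∧
        (¬ (a = i ∧ b = i ∧ x = x₀ ∧ y = y' ∧ z = z₀) → f (x⁻¹ * y * y'⁻¹ * z) = 0))
    (i₀ : ι) :
    3 * (2 : ℝ) ^ ((1 : ℝ) / 3) *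
        ∑ i, (((X i).card * (Y i).card * (Z i).card : ℕ) : ℝ) ^ ((2 : ℝ) / 3) ≤
      2 * (Module.finrank ℂ J : ℝ) + (X i₀).card + (Z i₀).card := by
  have hL : ∀ f ∈ J, ∀ a : G, (fun g : G => f (a * g)) ∈ J := fun f hf a => by
    simpa using hJ f hf a 1
  have hR : ∀ f ∈ J, ∀ b : G, (fun g : G => f (g * b)) ∈ J := fun f hf b => by
    simpa using hJ f hf 1 b
  have hNZ := familyNeumann_Z J hL X Y Z hX hY hsep i₀
  have hNX := familyNeumann_X J hR X Y Z hY hZ hsep i₀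
  have hsum : ∑ i, ((X i).card * (Y i).card + (Y i).card * (Z i).card +
      2 * ((Z i).card * (X i).card)) ≤ 2 * Module.finrank ℂ J + (X i₀).card + (Z i₀).card := by
    rw [Finset.sum_add_distrib, Finset.sum_add_distrib, ← Finset.mul_sum]
    omega
  have hsum' : ((∑ i, ((X i).card * (Y i).card + (Y i).card * (Z i).card +
      2 * ((Z i).card * (X i).card)) : ℕ) : ℝ) ≤
        2 * (Module.finrank ℂ J : ℝ) + (X i₀).card + (Z i₀).card := by exact_mod_cast hsum
  have hblocks : ∑ i, (2 : ℝ) ^ ((1 : ℝ) / 3) *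
      (((X i).card * (Y i).card * (Z i).card : ℕ) : ℝ) ^ ((2 : ℝ) / 3) ≤
      ∑ i, (((X i).card * (Y i).card + (Y i).card * (Z i).card +
        2 * ((Z i).card * (X i).card) : ℕ) : ℝ) / 3 :=
    Finset.sum_le_sum fun i _ => two_rpow_third_mul_rpow_two_thirds_le _ _ _
  rw [← Finset.sum_div, ← Finset.mul_sum] at hblocks
  push_cast at hsum' hblocks ⊢
  linarith

/-- **Tiling efficiency bound**: for a bi-invariant `J` and a simultaneously `J`-separated family
with non-empty blocks, `3·Σ_i (|X_i||Y_i||Z_i|)^{2/3} ≤ 2·dim J + 1` — the efficiency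
`η = Σ_i V_i^{2/3} / dim J` never exceeds `2/3 + 1/(3 dim J)`. -/
theorem three_mul_sum_rpow_le {G : Type} [Group G] {ι : Type} [Fintype G] [Fintype ι]
    (J : Submodule ℂ (G → ℂ))
    (hJ : ∀ f ∈ J, ∀ a b : G, (fun g : G => f (a * g * b)) ∈ J)
    (X Y Z : ι → Finset G) (hX : ∀ i, (X i).Nonempty) (hY : ∀ i, (Y i).Nonempty)
    (hZ : ∀ i, (Z i).Nonempty)
    (hsep : ∀ i : ι, ∀ x₀ ∈ X i, ∀ z₀ ∈ Z i, ∃ f ∈ J, ∀ a b : ι, ∀ x ∈ X a, ∀ y ∈ Y a,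
      ∀ y' ∈ Y b, ∀ z ∈ Z b,
        ((a = i ∧ b = i ∧ x = x₀ ∧ y = y' ∧ z = z₀) → f (x⁻¹ * y * y'⁻¹ * z) = 1) ∧
        (¬ (a = i ∧ b = i ∧ x = x₀ ∧ y = y' ∧ z = z₀) → f (x⁻¹ * y * y'⁻¹ * z) = 0)) :
    3 * ∑ i, (((X i).card * (Y i).card * (Z i).card : ℕ) : ℝ) ^ ((2 : ℝ) / 3) ≤
      2 * (Module.finrank ℂ J : ℝ) + 1 := by
  have hW := familyWalls_sum_le J hJ X Y Z hX hY hZ hsep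
  have hW' : ((∑ i, ((X i).card * (Y i).card + (Y i).card * (Z i).card +
      (Z i).card * (X i).card) : ℕ) : ℝ) ≤ 2 * (finrank ℂ J : ℝ) + 1 := by exact_mod_cast hW
  have hblocks : ∑ i, (((X i).card * (Y i).card * (Z i).card : ℕ) : ℝ) ^ ((2 : ℝ) / 3) ≤
      ∑ i, (((X i).card * (Y i).card + (Y i).card * (Z i).card + (Z i).card * (X i).card : ℕ)
        : ℝ) / 3 :=
    Finset.sum_le_sum fun i _ => rpow_two_thirds_le _ _ _
  rw [← Finset.sum_div] at hblocks
  push_cast at hW' hblocks ⊢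
  linarith


/-! ## The registered stub `stub_tilingFamilies` of line `tiling-families` is false -/

/-- **`stub_tilingFamilies` is false** (line `tiling-families` of crux `GradedDesignFamily`, registered
by the crux strategist, signature verbatim under the negation): there is NO `λ > 1` such that for every
`η < 1` some finite group carries a bi-invariant `J` with positive `Σ_{Irr∩J} χ(1)²`, and a
simultaneously `J`-separated family with `(λ χ(1))³ ≤ V_i` for all visible `χ` and
`η · Σ_{Irr∩J} χ(1)² ≤ Σ_i V_i^{2/3}`.  Indeed `dim J ≤ Σ_{Irr∩J} χ(1)² =: D`
(`finrank_le_gradedBudget_two`), every block is non-empty (`V_i ≥ λ³ > 1`), so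
`3 Σ_i V_i^{2/3} ≤ 2 dim J + 1 ≤ 2D + 1` (`three_mul_sum_rpow_le`); with `η = 11/12` this forces
`D ≤ 4/3`, while `Σ_i V_i^{2/3} > 1` forces `2 dim J + 1 > 3`, i.e. `dim J ≥ 2`, so `D ≥ 2`. -/
theorem tilingFamilies_false :
    ¬ (∃ lam : ℝ, 1 < lam ∧ ∀ η : ℝ, η < 1 → ∃ (G : Type) (_ : Group G) (_ : Fintype G)
      (J : Submodule ℂ (G → ℂ)) (t : ℕ) (X Y Z : Fin t → Finset G),
      (∀ f ∈ J, ∀ a b : G, (fun g : G => f (a * g * b)) ∈ J) ∧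
      (∀ i : Fin t, ∀ x₀ ∈ X i, ∀ z₀ ∈ Z i, ∃ f ∈ J, ∀ a b : Fin t, ∀ x ∈ X a, ∀ y ∈ Y a,
        ∀ y' ∈ Y b, ∀ z ∈ Z b,
          ((a = i ∧ b = i ∧ x = x₀ ∧ y = y' ∧ z = z₀) → f (x⁻¹ * y * y'⁻¹ * z) = 1) ∧
          (¬ (a = i ∧ b = i ∧ x = x₀ ∧ y = y' ∧ z = z₀) → f (x⁻¹ * y * y'⁻¹ * z) = 0)) ∧
      (0 < ∑ᶠ χ ∈ Literature.RepresentationTheory.FiniteGroups.irrChars G ∩ (J : Set (G → ℂ)),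
        (χ 1).re ^ (2 : ℝ)) ∧
      (∀ i : Fin t, ∀ χ ∈ Literature.RepresentationTheory.FiniteGroups.irrChars G ∩
        (J : Set (G → ℂ)),
          (lam * (χ 1).re) ^ (3 : ℕ) ≤ (((X i).card * (Y i).card * (Z i).card : ℕ) : ℝ)) ∧
      (η * ∑ᶠ χ ∈ Literature.RepresentationTheory.FiniteGroups.irrChars G ∩ (J : Set (G → ℂ)),
        (χ 1).re ^ (2 : ℝ) ≤
          ∑ i, (((X i).card * (Y i).card * (Z i).card : ℕ) : ℝ) ^ ((2 : ℝ) / 3))) := by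
  rintro ⟨lam, hlam, H⟩
  obtain ⟨G, _instG, _instF, J, t, X, Y, Z, hJ, hsep, hDpos, hvol, heta⟩ :=
    H (11 / 12) (by norm_num)
  set D : ℝ := ∑ᶠ χ ∈ irrChars G ∩ (J : Set (G → ℂ)), (χ 1).re ^ (2 : ℝ) with hDdef
  -- a visible irreducible character exists (else the budget is `0`)
  have hfin : (irrChars G ∩ (J : Set (G → ℂ))).Finite :=
    (irrChars_finite_holds G).subset Set.inter_subset_left
  obtain ⟨χ, hχ⟩ : (irrChars G ∩ (J : Set (G → ℂ))).Nonempty := by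
    by_contra hne
    rw [Set.not_nonempty_iff_eq_empty] at hne
    have : D = 0 := by rw [hDdef, hne]; simp
    linarith
  have hχ1 : (1 : ℝ) ≤ (χ 1).re := one_le_re_apply_one hχ.1
  -- every block has volume `> 1`, hence non-empty sides
  have hVgt : ∀ i, (1 : ℝ) < (((X i).card * (Y i).card * (Z i).card : ℕ) : ℝ) := fun i => by
    have h := hvol i χ hχ
    have h1 : (1 : ℝ) < lam * (χ 1).re := by nlinarith
    have h3 : (1 : ℝ) < (lam * (χ 1).re) ^ (3 : ℕ) := by
      have := one_lt_pow₀ h1 (n := 3) (by norm_num)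
      simpa using this
    linarith
  have hne : ∀ i, (X i).Nonempty ∧ (Y i).Nonempty ∧ (Z i).Nonempty := fun i => by
    have h := hVgt i
    have hpos : 0 < (X i).card * (Y i).card * (Z i).card := by exact_mod_cast (zero_lt_one.trans h)
    refine ⟨Finset.card_pos.mp ?_, Finset.card_pos.mp ?_, Finset.card_pos.mp ?_⟩
    · exact Nat.pos_of_ne_zero fun h0 => by simp [h0] at hpos
    · exact Nat.pos_of_ne_zero fun h0 => by simp [h0] at hpos
    · exact Nat.pos_of_ne_zero fun h0 => by simp [h0] at hpos
  -- the family Neumann consequence, with `dim J ≤ D`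
  have h3 := three_mul_sum_rpow_le J hJ X Y Z (fun i => (hne i).1) (fun i => (hne i).2.1)
    (fun i => (hne i).2.2) hsep
  have hdim : (finrank ℂ J : ℝ) ≤ D := finrank_le_gradedBudget_two J hJ
  set S : ℝ := ∑ i, (((X i).card * (Y i).card * (Z i).card : ℕ) : ℝ) ^ ((2 : ℝ) / 3) with hSdef
  -- lower bound `S ≥ λ² > 1` from any one block (`t ≥ 1` since `η D ≤ S` and `D > 0`)
  have hSpos : 0 < S := lt_of_lt_of_le (by positivity) heta
  have ht : 0 < t := by
    rcases Nat.eq_zero_or_pos t with h0 | h0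
    · subst h0
      simp [hSdef] at hSpos
    · exact h0
  have hSge : 1 < S := by
    let i₁ : Fin t := ⟨0, ht⟩
    have hterm : (1 : ℝ) < (((X i₁).card * (Y i₁).card * (Z i₁).card : ℕ) : ℝ) ^ ((2 : ℝ) / 3) :=
      Real.one_lt_rpow (hVgt i₁) (by norm_num)
    have hle : (((X i₁).card * (Y i₁).card * (Z i₁).card : ℕ) : ℝ) ^ ((2 : ℝ) / 3) ≤ S :=
      Finset.single_le_sum (f := fun i => (((X i).card * (Y i).card * (Z i).card : ℕ) : ℝ) ^
        ((2 : ℝ) / 3)) (fun i _ => by positivity) (Finset.mem_univ i₁)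
    linarith
  -- `S > 1` forces `dim J ≥ 2` (integrality), and then `11/12 · D ≤ S ≤ (2D+1)/3` is absurd
  have hfr : (1 : ℝ) < (finrank ℂ J : ℝ) := by linarith
  have hfr2 : (2 : ℝ) ≤ (finrank ℂ J : ℝ) := by
    have h : 1 < finrank ℂ J := by exact_mod_cast hfr
    exact_mod_cast h
  linarith

end Summit.MatrixMultiplication.MatrixMultiplication.Theorems.GradedDesignFamily.Negative

end
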